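import Literature.Barriers.NavierStokesRegularity.BuckmasterVicolNonuniquenessProofs
import Literature.Barriers.NavierStokesRegularity.SharpLpLinftyNonuniquenessMainTheoremHolds
import Literature.Analysis.FluidPDE.EulerReynolds
import HarnessLib

/-!
# Barrier (AnomalousDissipation), companion of `ConvexIntegrationNonLeray`: realisation by weak
  Navier–Stokes solutions is VACUOUS below `L²` strength in time (caveat (l) made a theorem)

D-0021 barrier audit (2026-08-17, generation 5) of
`Literature/Barriers/AnomalousDissipation/ConvexIntegrationNonLeray` and its proof file `…Proofs`.
The parent block bars the transfer of convex-integration Euler flows into a witness of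
`Literature.Turb.ZerothLaw` because their Leray–Hopf (or classical, same-force) vanishing-viscosity
REALISATION is a documented open problem, the printed reach being realisation by WEAK (Oseen)
solutions in the strong `C⁰_t L²_x` topology with uniform `C⁰_t H^β_x` bounds (Buckmaster–Vicol
2019, Thm. 1.3; tree theorem `BuckmasterVicol2019_thm13_holds`). Generation 4 recorded, as an
unproved audit remark (scope caveat (l) of the parent block), that realisation statements carry
information only from `L²_{t,x}` strength upwards: below it, "realisation by weak solutions" is
free. This file PROVES that remark from two theorems of the tree:

* `Literature.Barriers.NavierStokesRegularity.CheskidovLuo2022MainTheorem_holds` — the density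
  theorem of Cheskidov–Luo (Invent. Math. 229 (2022), Thm. 1.7, proved in the tree in every
  dimension): at viscosity `1`, every jointly smooth, divergence-free, zero-mean field `v` on
  `[0,T] × 𝕋ⁿ` is `ε`-close in `L^p(0,T; L^∞)`, `1 ≤ p < 2`, to a weak Navier–Stokes solution
  with datum `v(0)` ("the Laplacian plays no role", op. cit. §2.1);
* `Literature.Barriers.NavierStokesRegularity.isWeakNSSolutionOn_time_rescale` — the invariance
  `v ↦ μ v(μt, ·)`, `ν ↦ μν` of weak solutions on a fixed torus (Buckmaster–Vicol 2019, §2.4).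

Composing them (`w(t,x) = ν u(νt,x)` with `u` the Cheskidov–Luo solution near
`(s,x) ↦ ν⁻¹ U(s/ν, x)` on `[0, νT]`; the `L^p_t L^∞_x` distance scales by `ν^{1-1/p} ≤ 1`):

* `weakNS_realisation_LpLinfty` — for every `T > 0`, `1 ≤ p < 2`, `ε > 0`, EVERY viscosity
  `ν ∈ (0,1]` and EVERY field `U` jointly smooth on `[0,T] × T³` with divergence-free zero-mean
  slices — solving no equation whatsoever — there is a weak solution `w` of the unforced
  Navier–Stokes equations with viscosity `ν` on `T³ × (0,T)` (`Torus.IsWeakNSSolutionOn`, BV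
  Def. 1.1 without mean zero), of zero mean for a.e. `t`, in `L^p(0,T; L^∞)`, with
  `‖w - U‖_{L^p(0,T; L^∞(T³))} ≤ ε`;
* `weakNS_realisation_LpLinfty_seq` — hence along ANY prescribed viscosities `ν_n → 0`
  (`0 < ν_n ≤ 1`) there are weak solutions `w_n` of viscosity `ν_n` with
  `‖w_n - U‖_{L^p_t L^∞_x} ≤ 1/(n+1) → 0`.

(The rescaled solution even attains the datum `U(0)`, since the Cheskidov–Luo solution has datum
`ν⁻¹U(0)`; this refinement is not formalised here — the tree's rescaling lemma is stated for the
open-interval notion `Torus.IsWeakNSSolutionOn`.)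

What this says for the barrier. "`u` is a vanishing-viscosity limit of weak Navier–Stokes
solutions in `L^p_t L^∞_x`, `p < 2`" (or in any weaker topology: `L^p_t L^q_x`, `p < 2`;
distributions) holds for every smooth divergence-free field and therefore certifies NOTHING —
not even that `u` solves Euler, let alone anything about dissipation. The content of
Buckmaster–Vicol's Thm. 1.3 is entirely in its topology (`C⁰_t L²_x` convergence with uniform
`C⁰_t H^β_x` bounds, under which the nonlinearity converges in `C⁰_t L¹` and the limit must be a
weak Euler solution), and any realisation crux of a route must be at least `L²_{t,x}`-strong to be
informative (crux `VanishingViscosityRealizationV2` of route EulerLimit uses strong `L³_{t,x}`: on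
the informative side). The Cheskidov–Luo competitors have unbounded kinetic energy (op. cit.
Rem. 1.8), so none of this touches the Leray–Hopf question, which stays exactly where the parent
block puts it.

No named facts are introduced (theorems only; D-0026).

## References

* A. Cheskidov, X. Luo, *Sharp nonuniqueness for the Navier–Stokes equations*, Invent. Math. 229
  (2022), 987–1054 = arXiv:2009.06596: Thm. 1.7, Rem. 1.8, §2.1. [`CheskidovLuo2022`]
* T. Buckmaster, V. Vicol, Ann. of Math. 189 (2019): Def. 1.1, Thm. 1.3, §2.4 (scaling
  `ν ∈ (0,1]`). [`BuckmasterVicol2019Annals`]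
-/

noncomputable section

open MeasureTheory Set Filter Topology
open scoped ENNReal NNReal

namespace Literature.Barriers.AnomalousDissipation

open Literature.Analysis.FunctionSpaces Literature.Analysis.FluidPDE
open Literature.Barriers.NavierStokesRegularity

/-! ## Bookkeeping of the dilation `(s, x) ↦ (ν⁻¹ s, x)` and of `t ↦ ν g(νt)` -/

/-- Joint smoothness on `[0,T] × T³` transports to `(s,x) ↦ ν⁻¹ U(ν⁻¹ s, x)` on `[0, νT] × T³`.
[folklore] -/
theorem isSmoothSpaceTimeOn_inv_dilate {T ν : ℝ} (hν : 0 < ν)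
    {U : ℝ → UnitAddTorus (Fin 3) → EuclideanSpace ℝ (Fin 3)}
    (hU : Torus.IsSmoothSpaceTimeOn (Icc 0 T) U) :
    Torus.IsSmoothSpaceTimeOn (Icc 0 (ν * T)) (fun s x => ν⁻¹ • U (ν⁻¹ * s) x) := by
  have h : Torus.stLift (fun s x => ν⁻¹ • U (ν⁻¹ * s) x) =
      fun q : ℝ × EuclideanSpace ℝ (Fin 3) =>
        ν⁻¹ • (Torus.stLift U ∘
          fun q : ℝ × EuclideanSpace ℝ (Fin 3) => (ν⁻¹ * q.1, q.2)) q := by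
    funext q; rfl
  have hmaps : MapsTo (fun q : ℝ × EuclideanSpace ℝ (Fin 3) => (ν⁻¹ * q.1, q.2))
      (Icc 0 (ν * T) ×ˢ univ) (Icc 0 T ×ˢ univ) := by
    intro q hq
    refine mk_mem_prod ⟨mul_nonneg (inv_nonneg.2 hν.le) hq.1.1, ?_⟩ (mem_univ _)
    calc ν⁻¹ * q.1 ≤ ν⁻¹ * (ν * T) := mul_le_mul_of_nonneg_left hq.1.2 (inv_nonneg.2 hν.le)
      _ = T := inv_mul_cancel_left₀ hν.ne' T
  unfold Torus.IsSmoothSpaceTimeOn at hU ⊢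
  rw [h]
  exact (hU.comp ((contDiff_const.mul contDiff_fst).prodMk contDiff_snd).contDiffOn hmaps).const_smul
    ν⁻¹

/-- The mixed norm `L^q_t L^∞_x`, `0 < q < ∞`, of `t ↦ ν g(νt)` over `(0,T)` is
`ν · ν^{-1/q}` times that of `g` over `(0, νT)`. [folklore] -/
theorem eLqLpNorm_top_time_rescale {ν : ℝ} (hν : 0 < ν) {q : ℝ≥0∞} (hq0 : q ≠ 0) (hqt : q ≠ ∞)
    (T : ℝ) (g : ℝ → UnitAddTorus (Fin 3) → EuclideanSpace ℝ (Fin 3)) :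
    eLqLpNorm q ∞ (fun t x => ν • g (ν * t) x) (Ioo 0 T) =
      ENNReal.ofReal ν * ENNReal.ofReal ν⁻¹ ^ (1 / q.toReal) * eLqLpNorm q ∞ g (Ioo 0 (ν * T)) := by
  have hin : (fun t => (eLpNorm (fun x => ν • g (ν * t) x) ∞ volume).toReal) =
      ν • fun t => (eLpNorm (g (ν * t)) ∞ volume).toReal := by
    funext t
    have h1 : (fun x => ν • g (ν * t) x) = ν • g (ν * t) := rfl
    simp only [Pi.smul_apply, smul_eq_mul]
    rw [h1, eLpNorm_const_smul, ENNReal.toReal_mul, Real.enorm_eq_ofReal hν.le,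
      ENNReal.toReal_ofReal hν.le]
  have hL : eLpNorm (fun t => (eLpNorm (g (ν * t)) ∞ volume).toReal) q
        (volume.restrict (Ioo 0 T)) =
      ENNReal.ofReal ν⁻¹ ^ (1 / q.toReal) *
        eLpNorm (fun s => (eLpNorm (g s) ∞ volume).toReal) q
          (volume.restrict (Ioo 0 (ν * T))) := by
    rw [eLpNorm_eq_lintegral_rpow_enorm_toReal hq0 hqt,
      eLpNorm_eq_lintegral_rpow_enorm_toReal hq0 hqt,
      ← ENNReal.mul_rpow_of_nonneg _ _ (by positivity)]
    congr 1
    exact setLIntegral_Ioo_comp_mul_left hν T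
      (fun s => ‖(eLpNorm (g s) ∞ volume).toReal‖ₑ ^ q.toReal)
  unfold eLqLpNorm
  show eLpNorm (fun t => (eLpNorm (fun x => ν • g (ν * t) x) ∞ volume).toReal) q
      (volume.restrict (Ioo 0 T)) =
    ENNReal.ofReal ν * ENNReal.ofReal ν⁻¹ ^ (1 / q.toReal) *
      eLpNorm (fun s => (eLpNorm (g s) ∞ volume).toReal) q (volume.restrict (Ioo 0 (ν * T)))
  rw [hin, eLpNorm_const_smul, Real.enorm_eq_ofReal hν.le, hL, mul_assoc]

/-- The scaling factor `ν · ν^{-1/q} = ν^{1-1/q}` is at most `1` for `ν ≤ 1`, `q ≥ 1`. [folklore] -/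
theorem rescale_factor_le_one {ν : ℝ} (hν : 0 < ν) (hν1 : ν ≤ 1) {r : ℝ} (hr1 : r ≤ 1) : ENNReal.ofReal ν * ENNReal.ofReal ν⁻¹ ^ r ≤ 1 := by
  rw [ENNReal.ofReal_rpow_of_pos (inv_pos.2 hν), ← ENNReal.ofReal_mul hν.le]
  refine ENNReal.ofReal_le_one.2 ?_
  have h1 : (1 : ℝ) ≤ ν⁻¹ := one_le_inv_iff₀.2 ⟨hν, hν1⟩
  calc ν * ν⁻¹ ^ r ≤ ν * ν⁻¹ ^ (1 : ℝ) :=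
        mul_le_mul_of_nonneg_left (Real.rpow_le_rpow_of_exponent_le h1 hr1) hν.le
    _ = 1 := by rw [Real.rpow_one, mul_inv_cancel₀ hν.ne']

/-! ## The theorem -/

/-- **Realisation by weak Navier–Stokes solutions is vacuous in `L^p_t L^∞_x`, `p < 2`.** For
`T > 0`, `1 ≤ p < 2`, `ε > 0`, every viscosity `0 < ν ≤ 1` and every field `U` jointly smooth on
`[0,T] × T³` whose slices are divergence free and of zero mean (no equation is assumed), there is
a weak solution `w` of the unforced Navier–Stokes equations with viscosity `ν` on `T³ × (0,T)`
(`Torus.IsWeakNSSolutionOn`), of zero mean for a.e. `t ∈ (0,T)`, lying in `L^p(0,T; L^∞)`, with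
`‖w - U‖_{L^p(0,T; L^∞(T³))} ≤ ε`. Proof: apply the tree theorem of Cheskidov–Luo (Thm. 1.7,
viscosity `1`) on `[0, νT]` to `(s,x) ↦ ν⁻¹ U(ν⁻¹ s, x)` and rescale by
`w(t,x) = ν u(νt, x)` (`isWeakNSSolutionOn_time_rescale`); the `L^p_t L^∞_x` distance is
multiplied by `ν^{1-1/p} ≤ 1`. [cite: CheskidovLuo2022, Thm. 1.7 and §2.1] -/
theorem weakNS_realisation_LpLinfty {T : ℝ} (hT : 0 < T) {p : ℝ} (hp1 : 1 ≤ p) (hp2 : p < 2)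
    {ε : ℝ} (hε : 0 < ε) {ν : ℝ} (hν : 0 < ν) (hν1 : ν ≤ 1)
    (U : ℝ → UnitAddTorus (Fin 3) → EuclideanSpace ℝ (Fin 3))
    (hU : Torus.IsSmoothSpaceTimeOn (Icc 0 T) U) (hdiv : ∀ t ∈ Icc 0 T, Torus.IsDivFree (U t))
    (hmean : ∀ t ∈ Icc 0 T, Torus.HasZeroMean (U t)) :
    ∃ w : ℝ → UnitAddTorus (Fin 3) → EuclideanSpace ℝ (Fin 3),
      Torus.IsWeakNSSolutionOn T ν w ∧
      (∀ᵐ t ∂(volume.restrict (Ioo 0 T)), Torus.HasZeroMean (w t)) ∧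
      MemLqLp (ENNReal.ofReal p) ∞ w (Ioo 0 T) ∧
      eLqLpNorm (ENNReal.ofReal p) ∞ (w - U) (Ioo 0 T) ≤ ENNReal.ofReal ε := by
  -- the dilated comparison field on `[0, νT]`
  set V : ℝ → UnitAddTorus (Fin 3) → EuclideanSpace ℝ (Fin 3) := fun s x => ν⁻¹ • U (ν⁻¹ * s) x with hV
  have hmem : ∀ s ∈ Icc 0 (ν * T), ν⁻¹ * s ∈ Icc 0 T := fun s hs =>
    ⟨mul_nonneg (inv_nonneg.2 hν.le) hs.1,
      (mul_le_mul_of_nonneg_left hs.2 (inv_nonneg.2 hν.le)).trans_eq (inv_mul_cancel_left₀ hν.ne' T)⟩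
  have hVs : Torus.IsSmoothSpaceTimeOn (Icc 0 (ν * T)) V := isSmoothSpaceTimeOn_inv_dilate hν hU
  have hVdiv : ∀ s ∈ Icc 0 (ν * T), Torus.IsDivFree (V s) := by
    intro s hs x
    have hsm : Torus.IsContDiff 1 (U (ν⁻¹ * s)) := (hU.isSmooth_slice (hmem s hs)).isContDiff (by simp)
    have h : V s = ν⁻¹ • U (ν⁻¹ * s) := rfl
    rw [h, Torus.divergence_const_smul hsm, hdiv _ (hmem s hs) x, mul_zero]
  have hVmean : ∀ s ∈ Icc 0 (ν * T), Torus.HasZeroMean (V s) := by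
    intro s hs
    have h := hmean _ (hmem s hs)
    unfold Torus.HasZeroMean at h ⊢
    simp only [hV, integral_smul, h, smul_zero]
  -- Cheskidov–Luo at viscosity `1` on `[0, νT]`
  obtain ⟨u, hu, humean, huLp, -, -, hclose⟩ :=
    CheskidovLuo2022MainTheorem_holds 3 (by norm_num) (ν * T) (mul_pos hν hT) p hp1 hp2 ε hε V hVs
      hVdiv hVmean
  -- rescale to viscosity `ν` on `[0, T]`
  have hq0 : ENNReal.ofReal p ≠ 0 := (ENNReal.ofReal_pos.2 (by linarith)).ne'
  have hqt : ENNReal.ofReal p ≠ ∞ := ENNReal.ofReal_ne_top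
  have hqr : (ENNReal.ofReal p).toReal = p := ENNReal.toReal_ofReal (by linarith)
  have hfac : ENNReal.ofReal ν * ENNReal.ofReal ν⁻¹ ^ (1 / (ENNReal.ofReal p).toReal) ≤ 1 := by
    rw [hqr]
    exact rescale_factor_le_one hν hν1 ((div_le_one (by linarith)).2 hp1)
  refine ⟨fun t x => ν • u (ν * t) x, ?_, ?_, ⟨?_, ?_⟩, ?_⟩
  · have h := isWeakNSSolutionOn_time_rescale hν (T := T) (ν₁ := 1) (v := u) hu.isWeakNSSolutionOn
    rwa [mul_one] at h
  · filter_upwards [ae_restrict_Ioo_comp_mul_left hν humean] with t ht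
    unfold Torus.HasZeroMean at ht ⊢
    simp only [integral_smul, ht, smul_zero]
  · filter_upwards [ae_restrict_Ioo_comp_mul_left hν huLp.1] with t ht
    exact ht.const_smul ν
  · rw [eLqLpNorm_top_time_rescale hν hq0 hqt T u]
    exact ENNReal.mul_lt_top ((hfac.trans_lt ENNReal.one_lt_top)) huLp.2
  · have hsub : ((fun t x => ν • u (ν * t) x) - U) = fun t x => ν • (u - V) (ν * t) x := by
      funext t x
      simp only [Pi.sub_apply, hV, smul_sub, smul_smul, inv_mul_cancel_left₀ hν.ne',
        mul_inv_cancel₀ hν.ne', one_smul]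
    rw [hsub, eLqLpNorm_top_time_rescale hν hq0 hqt T (u - V)]
    calc ENNReal.ofReal ν * ENNReal.ofReal ν⁻¹ ^ (1 / (ENNReal.ofReal p).toReal) *
          eLqLpNorm (ENNReal.ofReal p) ∞ (u - V) (Ioo 0 (ν * T))
        ≤ 1 * ENNReal.ofReal ε := mul_le_mul' hfac hclose
      _ = ENNReal.ofReal ε := one_mul _

/-- **Sequential form.** Along ANY prescribed viscosities `ν_n → 0` with `0 < ν_n ≤ 1`, every
jointly smooth divergence-free zero-mean field `U` on `[0,T] × T³` is the `L^p(0,T; L^∞)`-limit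
(`1 ≤ p < 2`) of weak Navier–Stokes solutions `w_n` of viscosity `ν_n`:
`‖w_n - U‖_{L^p_t L^∞_x} ≤ 1/(n+1)`. "Vanishing-viscosity realisation by weak solutions" below
`L²` strength in time is therefore void of content (it does not even imply that `U` solves Euler).
[cite: CheskidovLuo2022, Thm. 1.7] -/
theorem weakNS_realisation_LpLinfty_seq {T : ℝ} (hT : 0 < T) {p : ℝ} (hp1 : 1 ≤ p) (hp2 : p < 2)
    {ν : ℕ → ℝ} (hν : ∀ n, 0 < ν n) (hν1 : ∀ n, ν n ≤ 1)
    (U : ℝ → UnitAddTorus (Fin 3) → EuclideanSpace ℝ (Fin 3))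
    (hU : Torus.IsSmoothSpaceTimeOn (Icc 0 T) U) (hdiv : ∀ t ∈ Icc 0 T, Torus.IsDivFree (U t))
    (hmean : ∀ t ∈ Icc 0 T, Torus.HasZeroMean (U t)) :
    ∃ w : ℕ → ℝ → UnitAddTorus (Fin 3) → EuclideanSpace ℝ (Fin 3),
      (∀ n, Torus.IsWeakNSSolutionOn T (ν n) (w n)) ∧
      (∀ n, ∀ᵐ t ∂(volume.restrict (Ioo 0 T)), Torus.HasZeroMean (w n t)) ∧
      (∀ n, MemLqLp (ENNReal.ofReal p) ∞ (w n) (Ioo 0 T)) ∧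
      (∀ n, eLqLpNorm (ENNReal.ofReal p) ∞ (w n - U) (Ioo 0 T) ≤ ENNReal.ofReal (1 / ((n : ℝ) + 1))) ∧
      Tendsto (fun n => eLqLpNorm (ENNReal.ofReal p) ∞ (w n - U) (Ioo 0 T)) atTop (𝓝 0) := by
  have step : ∀ n : ℕ, ∃ w : ℝ → UnitAddTorus (Fin 3) → EuclideanSpace ℝ (Fin 3),
      Torus.IsWeakNSSolutionOn T (ν n) w ∧
      (∀ᵐ t ∂(volume.restrict (Ioo 0 T)), Torus.HasZeroMean (w t)) ∧
      MemLqLp (ENNReal.ofReal p) ∞ w (Ioo 0 T) ∧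
      eLqLpNorm (ENNReal.ofReal p) ∞ (w - U) (Ioo 0 T) ≤ ENNReal.ofReal (1 / ((n : ℝ) + 1)) :=
    fun n => weakNS_realisation_LpLinfty hT hp1 hp2 (by positivity) (hν n) (hν1 n) U hU hdiv hmean
  choose w hw hmean' hLp hclose using step
  refine ⟨w, hw, hmean', hLp, hclose, ?_⟩
  refine tendsto_of_tendsto_of_tendsto_of_le_of_le tendsto_const_nhds ?_ (fun _ => zero_le) hclose
  rw [← ENNReal.ofReal_zero]
  exact ENNReal.tendsto_ofReal tendsto_one_div_add_atTop_nhds_zero_nat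

end Literature.Barriers.AnomalousDissipation

end
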